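import Summits.ValiantsHypothesis.ValiantsHypothesis.Theorems.GrenetZeonTwoDimCoefficientsUnitReducedPoint
import Summits.ValiantsHypothesis.ValiantsHypothesis.Theorems.GrenetZeonTwoDimCoefficientsUnitReducedRescale
import Summits.ValiantsHypothesis.ValiantsHypothesis.Theorems.GrenetZeonTwoDimCoefficientsSmallRoot
import HarnessLib

/-!
# Crux `GrenetZeon.TwoDimCoefficients` (stmt-ValiantsHypothesis-8062), line `dim2_cases`:
# the REDUCED unit case — a Mignon–Ressayre point at infinity (assembly)

The provable half of the registered stub `stub_unitDichotomy` (see the seat's census attached to the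
item and `…GrenetZeonTwoDimCoefficientsUnitCase`): **if an affine `m × m` determinant over `ℂ[x]` is
`det A = c + per_n · q` (`n ≥ 3`, `q ≠ 0`) and the TOP homogeneous component of `q` is not divisible
by `per_n` — automatic when `deg q < n` — then `n² ≤ 2m + 2`**
(`sq_le_two_mul_add_two_of_det_eq_of_not_dvd`, `…_of_totalDegree_lt`).  This is the lower bound
`dc(c + per_n·q) ≥ (n² - 2)/2` for such `q`, a modest generalisation of Mignon–Ressayre (`q = 1`).

Proof (the line card's "asymptotic Mignon–Ressayre point", made exact).
1. (`…UnitReducedPoint`) A point `p₁ ∈ Z(per_n)` with `q_k(p₁) ≠ 0`, `Hess per_n(p₁)` invertible, and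
   a coordinate `i` with `∂ᵢ per_n(p₁) ≠ 0`.
2. (`…UnitReducedRescale`) For `ε ≠ 0`, `ĝ_ε := c ε^D + per_n · q̂_ε` (`q̂_ε = Σ_e ε^{k-e} q_e`,
   `D = n + k`) satisfies `ĝ_ε(x) = ε^D det A(x/ε)` and is an affine `m × m` determinant, so
   Mignon–Ressayre (tree: `rank_hessianMatrix_le_two_mul_of_isAffineDetRepr`) bounds the rank of
   its Hessian by `2m` at each of its zeros.
3. `Hess ĝ_ε(x) = W(ε, x) + (rank ≤ 2)` with `W(ε, x) = q̂_ε(x) Hess per_n(x) + per_n(x) Hess q̂_ε(x)`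
   continuous in `(ε, x)` and `W(0, p₁) = q_k(p₁) · Hess per_n(p₁)` invertible; so `W` is invertible
   near `(0, p₁)` (continuity of `det`).
4. On the line `τ ↦ p₁ + τ eᵢ`, `h_ε(τ) := ĝ_ε(p₁ + τeᵢ)` has `h_ε(0) = c ε^D`,
   `h_ε'(0) = ∂ᵢper_n(p₁) · q̂_ε(p₁)` with `q̂_ε(p₁) → q_k(p₁) ≠ 0`, and degree bounded independently
   of `ε`; the small-root lemma (`exists_isRoot_norm_mul_le`) gives a zero `τ(ε) = O(ε^D)` of `h_ε`.
5. For small real `ε > 0`, at the zero `x = p₁ + τ(ε)eᵢ` of `ĝ_ε`: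
   `n² = rank W(ε, x) ≤ rank Hess ĝ_ε(x) + 2 ≤ 2m + 2`.

HONEST FRAMING: serves an ASIDE item; says nothing about the powerful unit case
(`det A = ((per_n+1)/2)²`, …) where the Hessian method is void; `VP ≠ VNP` is not moved.

References: T. Mignon, N. Ressayre, *A quadratic bound for the determinant and permanent problem*,
Int. Math. Res. Not. 2004:79, Thm. 1.1; J. M. Landsberg, *Geometry and Complexity Theory* (2017),
§6.4.6.
-/

set_option linter.dupNamespace false

noncomputable section

namespace Summit.ValiantsHypothesis.ValiantsHypothesis.Cruxes.TwoDimCoefficients.DimTwoCases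

open MvPolynomial Matrix
open Literature.Computability.AlgebraicComplexity

/-! ### Steps 3–5: assembly -/

section Assembly

/-- Rank is subadditive under subtraction. -/
theorem rank_sub_le' {ι : Type*} [Fintype ι] (M N : Matrix ι ι ℂ) :
    (M - N).rank ≤ M.rank + N.rank := by
  rw [sub_eq_add_neg, ← neg_one_smul ℂ N]
  exact (rank_add_le _ _).trans (Nat.add_le_add_left (rank_smul_le _ _) _)

/-- **The reduced unit case** (`n = k + 3`).  If `det A = c + per_n · q` for an affine `m × m`
matrix `A`, `q ≠ 0`, and `per_n` does not divide the top homogeneous component of `q`, then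
`n² ≤ 2m + 2`. -/
theorem sq_le_two_mul_add_two_of_not_dvd {k m : ℕ} (A : AffMat (k + 3) m) (hA : IsAffine A)
    {c : ℂ} {q : MvPolynomial (Fin (k + 3) × Fin (k + 3)) ℂ} (hq : q ≠ 0)
    (hdet : A.det = C c + perPoly (Fin (k + 3)) ℂ * q)
    (htop : ¬ perPoly (Fin (k + 3)) ℂ ∣ homogeneousComponent q.totalDegree q) :
    (k + 3) ^ 2 ≤ 2 * m + 2 := by
  classical
  set per := perPoly (Fin (k + 3)) ℂ with hper
  set kq := q.totalDegree with hkq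
  set D := k + 3 + kq with hD
  -- Step 1: the good point
  obtain ⟨p₁, i, hp₁, hb, hHunit, ha⟩ := exists_goodPoint k (homogeneousComponent kq q) htop
  set a : ℂ := eval p₁ (pderiv i per) with ha_def
  set b : ℂ := eval p₁ (homogeneousComponent kq q) with hb_def
  -- the rescaled cofactor `q̂_ε` and polynomial `ĝ_ε` (opaque names with defining equations)
  obtain ⟨qh, hqh⟩ : ∃ qh : ℂ → MvPolynomial (Fin (k + 3) × Fin (k + 3)) ℂ, qh = fun ε =>
      ∑ e ∈ Finset.range (kq + 1), C (ε ^ (kq - e)) * homogeneousComponent e q := ⟨_, rfl⟩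
  obtain ⟨gh, hgh⟩ : ∃ gh : ℂ → MvPolynomial (Fin (k + 3) × Fin (k + 3)) ℂ, gh = fun ε =>
      C (c * ε ^ D) + per * qh ε := ⟨_, rfl⟩
  have hqh_eval : ∀ ε x, eval x (qh ε) =
      ∑ e ∈ Finset.range (kq + 1), ε ^ (kq - e) * eval x (homogeneousComponent e q) := by
    intro ε x
    simp only [hqh, map_sum, map_mul, eval_C]
  have hqh_hess : ∀ ε x, hessianMatrix (qh ε) x =
      ∑ e ∈ Finset.range (kq + 1), ε ^ (kq - e) • hessianMatrix (homogeneousComponent e q) x := by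
    intro ε x
    simp only [hqh, hessianMatrix_sum, hessianMatrix_C_mul]
  -- Step 2: Mignon–Ressayre for `ĝ_ε`
  have hMR : ∀ ε ≠ 0, ∀ x, eval x (gh ε) = 0 → (hessianMatrix (gh ε) x).rank ≤ 2 * m := by
    intro ε hε x hx
    obtain ⟨B, hB⟩ := hasAffineDetRepr_rescale A hA (by omega) hq hdet hε
    simp only [hgh, hqh] at hx ⊢
    have h := rank_hessianMatrix_le_two_mul_of_isAffineDetRepr hB x hx
    rwa [Fintype.card_fin] at h
  -- Step 3: the matrix `W(ε, x)`
  obtain ⟨W, hW⟩ : ∃ W : ℂ × (Fin (k + 3) × Fin (k + 3) → ℂ) →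
      Matrix (Fin (k + 3) × Fin (k + 3)) (Fin (k + 3) × Fin (k + 3)) ℂ, W = fun z =>
      eval z.2 (qh z.1) • hessianMatrix per z.2 + eval z.2 per • hessianMatrix (qh z.1) z.2 :=
    ⟨_, rfl⟩
  have hHess : ∀ ε x, hessianMatrix (gh ε) x = W (ε, x) +
      (vecMulVec (fun s => eval x (pderiv s per)) (fun s => eval x (pderiv s (qh ε))) +
        vecMulVec (fun s => eval x (pderiv s (qh ε))) (fun s => eval x (pderiv s per))) := by
    intro ε x
    simp only [hgh, hW, hessianMatrix_C_add, hessianMatrix_mul]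
    abel
  have hrankW : ∀ ε ≠ 0, ∀ x, eval x (gh ε) = 0 → (W (ε, x)).rank ≤ 2 * m + 2 := by
    intro ε hε x hx
    have h1 := hMR ε hε x hx
    have hR := rank_vecMulVec_add_vecMulVec_le (K := ℂ) (fun s => eval x (pderiv s per))
      (fun s => eval x (pderiv s (qh ε))) (fun s => eval x (pderiv s (qh ε)))
      (fun s => eval x (pderiv s per))
    have hWeq : W (ε, x) = hessianMatrix (gh ε) x -
        (vecMulVec (fun s => eval x (pderiv s per)) (fun s => eval x (pderiv s (qh ε))) +
          vecMulVec (fun s => eval x (pderiv s (qh ε))) (fun s => eval x (pderiv s per))) := by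
      rw [hHess]; abel
    rw [hWeq]
    refine (rank_sub_le' _ _).trans ?_
    omega
  -- continuity of `W` and its value at `(0, p₁)`
  have hHcont : ∀ f : MvPolynomial (Fin (k + 3) × Fin (k + 3)) ℂ,
      Continuous fun z : ℂ × (Fin (k + 3) × Fin (k + 3) → ℂ) => hessianMatrix f z.2 := by
    intro f
    refine continuous_matrix fun u v => ?_
    simp only [hessianMatrix_apply]
    exact (MvPolynomial.continuous_eval _).comp continuous_snd
  have hfst : Continuous fun z : ℂ × (Fin (k + 3) × Fin (k + 3) → ℂ) => z.1 := continuous_fst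
  have hWcont : Continuous W := by
    have hWexp : W = fun z =>
        (∑ e ∈ Finset.range (kq + 1), z.1 ^ (kq - e) * eval z.2 (homogeneousComponent e q)) •
            hessianMatrix per z.2 +
          eval z.2 per • ∑ e ∈ Finset.range (kq + 1),
            z.1 ^ (kq - e) • hessianMatrix (homogeneousComponent e q) z.2 := by
      funext z
      simp only [hW, hqh_eval, hqh_hess]
    rw [hWexp]
    have hs1 : Continuous fun z : ℂ × (Fin (k + 3) × Fin (k + 3) → ℂ) =>
        ∑ e ∈ Finset.range (kq + 1), z.1 ^ (kq - e) * eval z.2 (homogeneousComponent e q) :=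
      continuous_finsetSum _ fun e _ =>
        (hfst.pow _).mul ((MvPolynomial.continuous_eval _).comp continuous_snd)
    have hs2 : Continuous fun z : ℂ × (Fin (k + 3) × Fin (k + 3) → ℂ) => eval z.2 per :=
      (MvPolynomial.continuous_eval _).comp continuous_snd
    have hs3 : Continuous fun z : ℂ × (Fin (k + 3) × Fin (k + 3) → ℂ) =>
        ∑ e ∈ Finset.range (kq + 1), z.1 ^ (kq - e) • hessianMatrix (homogeneousComponent e q) z.2 :=
      continuous_finsetSum _ fun e _ =>
        ((hfst.pow (kq - e)).smul (hHcont (homogeneousComponent e q)):)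
    exact (hs1.smul (hHcont per)).add (hs2.smul hs3)
  have hsum0 : ∑ e ∈ Finset.range (kq + 1), (0 : ℂ) ^ (kq - e) * eval p₁ (homogeneousComponent e q)
      = b := by
    rw [Finset.sum_eq_single kq]
    · rw [Nat.sub_self, pow_zero, one_mul]
    · intro e he hne
      have : kq - e ≠ 0 := by
        have := Finset.mem_range.mp he
        omega
      rw [zero_pow this, zero_mul]
    · intro h
      exact absurd (Finset.self_mem_range_succ kq) h
  have hW0 : W (0, p₁) = b • hessianMatrix per p₁ := by
    simp only [hW]
    rw [hqh_eval, hsum0, hp₁, zero_smul, add_zero]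
  have hdet0 : (W (0, p₁)).det ≠ 0 := by
    rw [hW0, Matrix.det_smul]
    exact mul_ne_zero (pow_ne_zero _ hb) hHunit.ne_zero
  obtain ⟨δ, hδ, hδW⟩ : ∃ δ > 0, ∀ z : ℂ × (Fin (k + 3) × Fin (k + 3) → ℂ),
      dist z (0, p₁) < δ → (W z).det ≠ 0 := by
    have hc : ContinuousAt (fun z => (W z).det) (0, p₁) := hWcont.matrix_det.continuousAt
    exact Metric.eventually_nhds_iff.mp (hc.eventually_ne hdet0)
  -- continuity of `ε ↦ q̂_ε(p₁)` at `0`, where the value is `b ≠ 0`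
  have hB : 0 < ‖b‖ := norm_pos_iff.mpr hb
  obtain ⟨δ₁, hδ₁, hδ₁q⟩ : ∃ δ₁ > 0, ∀ ε : ℂ, dist ε 0 < δ₁ →
      dist (eval p₁ (qh ε)) b < ‖b‖ / 2 := by
    have hf : Continuous fun ε : ℂ =>
        ∑ e ∈ Finset.range (kq + 1), ε ^ (kq - e) * eval p₁ (homogeneousComponent e q) :=
      continuous_finsetSum _ fun e _ => (continuous_pow _).mul continuous_const
    have hca : ContinuousAt (fun ε : ℂ =>
        ∑ e ∈ Finset.range (kq + 1), ε ^ (kq - e) * eval p₁ (homogeneousComponent e q)) 0 :=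
      hf.continuousAt
    obtain ⟨δ₁, hδ₁, h⟩ := Metric.continuousAt_iff.mp hca (‖b‖ / 2) (by positivity)
    refine ⟨δ₁, hδ₁, fun ε hε => ?_⟩
    have h' := h hε
    rwa [hsum0, ← hqh_eval] at h'
  -- Step 4 (algebra): the line polynomial `h_ε`
  obtain ⟨L, hL⟩ : ∃ L : Fin (k + 3) × Fin (k + 3) → Polynomial ℂ,
      L = fun j => Polynomial.C (p₁ j) + Pi.single (M := fun _ => Polynomial ℂ) i Polynomial.X j :=
    ⟨_, rfl⟩
  obtain ⟨Nmax, hNmax⟩ : ∃ Nmax : ℕ, Nmax = (aeval L per).natDegree +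
      ∑ e ∈ Finset.range (kq + 1), (aeval L (homogeneousComponent e q)).natDegree := ⟨_, rfl⟩
  have hcoef0 : ∀ ε, (aeval L (gh ε)).coeff 0 = c * ε ^ D := by
    intro ε
    rw [hL, coeff_zero_aeval_lineMap]
    simp only [hgh]
    rw [map_add, eval_C, map_mul, hp₁, zero_mul, add_zero]
  have hcoef1 : ∀ ε, (aeval L (gh ε)).coeff 1 = a * eval p₁ (qh ε) := by
    intro ε
    rw [hL, coeff_one_aeval_lineMap]
    simp only [hgh]
    rw [map_add, pderiv_C, zero_add, pderiv_mul, map_add, map_mul, map_mul, hp₁, zero_mul,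
      add_zero]
  have hdegle : ∀ ε, (aeval L (gh ε)).natDegree ≤ Nmax := by
    intro ε
    have e1 : aeval L (gh ε) = Polynomial.C (c * ε ^ D) + aeval L per * aeval L (qh ε) := by
      simp only [hgh]
      rw [map_add, map_mul (aeval L) per (qh ε), aeval_C, Polynomial.algebraMap_eq]
    have e2 : aeval L (qh ε) = ∑ e ∈ Finset.range (kq + 1),
        Polynomial.C (ε ^ (kq - e)) * aeval L (homogeneousComponent e q) := by
      simp only [hqh]
      rw [map_sum]
      refine Finset.sum_congr rfl fun e _ => ?_
      rw [map_mul (aeval L), aeval_C, Polynomial.algebraMap_eq]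
    have hS : (aeval L (qh ε)).natDegree ≤
        ∑ e ∈ Finset.range (kq + 1), (aeval L (homogeneousComponent e q)).natDegree := by
      rw [e2]
      exact Polynomial.natDegree_sum_le_of_forall_le _ _ fun e he =>
        (Polynomial.natDegree_C_mul_le _ _).trans
          (Finset.single_le_sum (f := fun e => (aeval L (homogeneousComponent e q)).natDegree)
            (fun _ _ => Nat.zero_le _) he)
    have hPS : (aeval L per * aeval L (qh ε)).natDegree ≤
        (aeval L per).natDegree + (aeval L (qh ε)).natDegree := Polynomial.natDegree_mul_le
    have hC0 : (Polynomial.C (c * ε ^ D)).natDegree = 0 := Polynomial.natDegree_C _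
    have hadd := Polynomial.natDegree_add_le (Polynomial.C (c * ε ^ D)) (aeval L per * aeval L (qh ε))
    rw [hC0] at hadd
    rw [e1, hNmax]
    refine hadd.trans ?_
    refine max_le (Nat.zero_le _) ?_
    exact hPS.trans (Nat.add_le_add_left hS _)
  -- Step 5: choose `ε`
  set aN : ℝ := ‖a‖ with haN
  have haN0 : 0 < aN := norm_pos_iff.mpr ha
  set K : ℝ := 2 * Nmax * ‖c‖ / (aN * ‖b‖) with hK
  have hK0 : 0 ≤ K := by positivity
  have hKd : 0 < δ / (K + 1) := by positivity
  set r : ℝ := min (min 1 δ₁) (min δ (δ / (K + 1))) / 2 with hr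
  have hmin : 0 < min (min 1 δ₁) (min δ (δ / (K + 1))) :=
    lt_min (lt_min one_pos hδ₁) (lt_min hδ hKd)
  have hr0 : 0 < r := by rw [hr]; linarith
  have hrle : ∀ X, min (min 1 δ₁) (min δ (δ / (K + 1))) ≤ X → 0 < X → r < X := by
    intro X hX hXpos
    rw [hr]; linarith
  have hr1 : r < 1 := hrle 1 ((min_le_left _ _).trans (min_le_left _ _)) one_pos
  have hrδ₁ : r < δ₁ := hrle δ₁ ((min_le_left _ _).trans (min_le_right _ _)) hδ₁
  have hrδ : r < δ := hrle δ ((min_le_right _ _).trans (min_le_left _ _)) hδ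
  have hrK : r < δ / (K + 1) := hrle _ ((min_le_right _ _).trans (min_le_right _ _)) hKd
  set ε : ℂ := (r : ℂ) with hε
  have hεnorm : ‖ε‖ = r := Complex.norm_of_nonneg hr0.le
  have hε0 : ε ≠ 0 := by
    rw [← norm_pos_iff, hεnorm]; exact hr0
  -- `q̂_ε(p₁)` is close to `b`, hence non-zero
  have hqb : ‖b‖ / 2 ≤ ‖eval p₁ (qh ε)‖ := by
    have h := hδ₁q ε (by rwa [dist_zero_right, hεnorm])
    rw [dist_eq_norm] at h
    have h3 : ‖b‖ ≤ ‖eval p₁ (qh ε)‖ + ‖eval p₁ (qh ε) - b‖ := by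
      have := norm_sub_le (eval p₁ (qh ε)) (eval p₁ (qh ε) - b)
      rwa [sub_sub_cancel] at this
    linarith
  have hqh0 : eval p₁ (qh ε) ≠ 0 := by
    rw [← norm_pos_iff]; linarith
  -- the small root
  have hc1 : (aeval L (gh ε)).coeff 1 ≠ 0 := by
    rw [hcoef1]; exact mul_ne_zero ha hqh0
  obtain ⟨τ, hroot, hτ⟩ := exists_isRoot_norm_mul_le _ (aeval L (gh ε)) rfl hc1
  -- `‖τ‖ < δ`
  have hτδ : ‖τ‖ < δ := by
    rw [hcoef1, hcoef0, norm_mul, norm_mul, norm_pow, hεnorm] at hτ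
    have hN : ((aeval L (gh ε)).natDegree : ℝ) ≤ Nmax := by exact_mod_cast hdegle ε
    have hrD : r ^ D ≤ r := by
      have : r ^ D ≤ r ^ 1 := pow_le_pow_of_le_one hr0.le hr1.le (by omega)
      rwa [pow_one] at this
    have h1 : ‖τ‖ * (aN * (‖b‖ / 2)) ≤ (Nmax : ℝ) * (‖c‖ * r) := by
      calc ‖τ‖ * (aN * (‖b‖ / 2)) ≤ ‖τ‖ * (‖a‖ * ‖eval p₁ (qh ε)‖) := by
            refine mul_le_mul_of_nonneg_left ?_ (norm_nonneg _)
            exact mul_le_mul_of_nonneg_left hqb haN0.le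
        _ ≤ ((aeval L (gh ε)).natDegree : ℝ) * (‖c‖ * r ^ D) := hτ
        _ ≤ (Nmax : ℝ) * (‖c‖ * r) := by
            refine mul_le_mul hN (mul_le_mul_of_nonneg_left hrD (norm_nonneg _)) (by positivity)
              (by positivity)
    have hpos : 0 < aN * (‖b‖ / 2) := by positivity
    have h2 : ‖τ‖ ≤ K * r := by
      have h1' := (le_div_iff₀ hpos).mpr h1
      refine h1'.trans (le_of_eq ?_)
      rw [hK]
      have e1 : aN ≠ 0 := haN0.ne'
      have e2 : ‖b‖ ≠ 0 := hB.ne'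
      field_simp
    have h3 : K * r ≤ K * (δ / (K + 1)) := mul_le_mul_of_nonneg_left hrK.le hK0
    have h4 : K * (δ / (K + 1)) < δ := by
      have hlt : K / (K + 1) < 1 := (div_lt_one (by positivity)).mpr (by linarith)
      calc K * (δ / (K + 1)) = δ * (K / (K + 1)) := by ring
        _ < δ * 1 := mul_lt_mul_of_pos_left hlt hδ
        _ = δ := mul_one δ
    linarith
  -- the zero `x_ε`
  set x : Fin (k + 3) × Fin (k + 3) → ℂ := p₁ + τ • Pi.single i 1 with hx
  have hzero : eval x (gh ε) = 0 := by
    have h := hroot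
    rw [Polynomial.IsRoot, hL, eval_aeval_lineMap] at h
    rw [hx]
    exact h
  have hdist : dist (ε, x) ((0 : ℂ), p₁) < δ := by
    rw [Prod.dist_eq]
    refine max_lt ?_ ?_
    · show dist ε 0 < δ
      rw [dist_zero_right, hεnorm]; exact hrδ
    · show dist x p₁ < δ
      rw [dist_eq_norm, hx, add_sub_cancel_left, norm_smul, Pi.norm_single, norm_one, mul_one]
      exact hτδ
  -- conclusion
  have hfull : (W (ε, x)).rank = (k + 3) ^ 2 := by
    rw [Matrix.rank_of_isUnit _ ((Matrix.isUnit_iff_isUnit_det _).mpr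
      (isUnit_iff_ne_zero.mpr (hδW _ hdist))), Fintype.card_prod, Fintype.card_fin, sq]
  have hfin := hrankW ε hε0 x hzero
  rw [hfull] at hfin
  exact hfin

/-- **The reduced unit case, `n ≥ 3` form** (the provable part of the registered `UnitDichotomy`
beyond `unit_trichotomy`): for an affine `m × m` matrix `A` with `det A = c + per_n·q`, `q ≠ 0`,
and `per_n ∤ top(q)`, we have `n² ≤ 2m + 2`.  In particular this holds whenever `deg q < n`. -/
theorem sq_le_two_mul_add_two_of_det_eq_of_not_dvd {n m : ℕ} (hn : 3 ≤ n) (A : AffMat n m)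
    (hA : IsAffine A) {c : ℂ} {q : MvPolynomial (Fin n × Fin n) ℂ} (hq : q ≠ 0)
    (hdet : A.det = C c + perPoly (Fin n) ℂ * q)
    (htop : ¬ perPoly (Fin n) ℂ ∣ homogeneousComponent q.totalDegree q) :
    n ^ 2 ≤ 2 * m + 2 := by
  obtain ⟨k, rfl⟩ : ∃ k, n = k + 3 := ⟨n - 3, by omega⟩
  exact sq_le_two_mul_add_two_of_not_dvd A hA hq hdet htop

/-- Corollary: `det A = c + per_n · q` with `q ≠ 0` of degree `< n` forces `n² ≤ 2m + 2`
(a non-zero form of degree `< n` is never a multiple of `per_n`). -/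
theorem sq_le_two_mul_add_two_of_det_eq_of_totalDegree_lt {n m : ℕ} (hn : 3 ≤ n) (A : AffMat n m)
    (hA : IsAffine A) {c : ℂ} {q : MvPolynomial (Fin n × Fin n) ℂ} (hq : q ≠ 0)
    (hdet : A.det = C c + perPoly (Fin n) ℂ * q) (hdeg : q.totalDegree < n) :
    n ^ 2 ≤ 2 * m + 2 := by
  haveI : Nonempty (Fin n) := ⟨⟨0, by omega⟩⟩
  refine sq_le_two_mul_add_two_of_det_eq_of_not_dvd hn A hA hq hdet fun ⟨r, hr⟩ => ?_
  -- the top component is non-zero, of degree `deg q < n`; a non-zero multiple of `per_n` has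
  -- degree `≥ n`
  have htopne : homogeneousComponent q.totalDegree q ≠ 0 := by
    intro h0
    apply hq
    -- if the top component vanished, all coefficients of top degree would vanish
    have hsupp : q.support.Nonempty := by
      rw [Finset.nonempty_iff_ne_empty, Ne, MvPolynomial.support_eq_empty]; exact hq
    obtain ⟨d, hd, hdeg'⟩ := Finset.exists_mem_eq_sup _ hsupp fun s : (Fin n × Fin n) →₀ ℕ =>
      (s.sum fun _ e => e)
    have hcoeff : coeff d (homogeneousComponent q.totalDegree q) = coeff d q := by
      rw [coeff_homogeneousComponent, if_pos]
      rw [Finsupp.degree_apply, MvPolynomial.totalDegree, hdeg']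
      rfl
    rw [h0, coeff_zero] at hcoeff
    exact absurd hcoeff.symm (mem_support_iff.mp hd)
  have hr0 : r ≠ 0 := by
    rintro rfl; rw [mul_zero] at hr; exact htopne hr
  have h1 : (homogeneousComponent q.totalDegree q).totalDegree = n + r.totalDegree := by
    rw [hr, totalDegree_mul_of_isDomain (perPoly_irreducible (n := Fin n) (R := ℂ)).ne_zero hr0,
      (totalDegree_perPoly_holds (n := Fin n) (k := ℂ) : (perPoly (Fin n) ℂ).totalDegree = _),
      Fintype.card_fin]
  have h2 : (homogeneousComponent q.totalDegree q).totalDegree = q.totalDegree :=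
    (homogeneousComponent_isHomogeneous _ q).totalDegree htopne
  omega

end Assembly

end Summit.ValiantsHypothesis.ValiantsHypothesis.Cruxes.TwoDimCoefficients.DimTwoCases
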